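import Summits.Ventures.YMGap.RobustBall.OneStateTailTrivial
import HarnessLib

/-!
# Venture YMGap, track ROBUST-BALL — ONE STATE, structure (continued): the one state is MIXING under lattice translations on ALL events

HONEST FRAMING. WHAT THIS IS: a venture file (cell `pub-ymgap`, track Y2 ROBUST-BALL, seat ds-3, theorems only) continuing
`OneStateTailTrivial.lean`. There: uniqueness ⇒ tail triviality ⇒ short-range correlations for ALL events and ergodicity under every
non-zero translation. Here the quantitative-free MIXING statement that the cell's clustering clause gives only for Lipschitz cylinder
observables: under `MassGapAt d N β`, for the one state `μ`, EVERY event `A` and every CYLINDER event `B` (determined by finitely many links),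
`μ(A ∩ θ_v⁻¹ B) → μ(A) μ(B)` as `v → ∞` in `ℤ^d` (cofinite filter) — `oneState_mixing_of_massGapAt`; the `SU(2)` cell
`su2_wilson_oneState_mixing` (`|b| ≤ 9/50`). Mechanism: Georgii Prop. 7.9 (short-range correlations of a tail-trivial state, lit
`IsTailTrivial.exists_finset_abs_measureReal_inter_sub_le`) + translation invariance; the translate of a cylinder event on `s` is
determined off `Λ` as soon as `s − v` misses `Λ`, which fails for finitely many `v` only.
WHAT THIS IS NOT: no rate (rates are for Lipschitz observables, `BoundaryDecay*.lean` and the cell's `MassGapAt` clause); lattice only;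
nothing about the continuum limit or the Clay Millennium problem.

References: H.-O. Georgii (2011), Prop. 7.9, Prop. 14.9; lit `TailTrivialMixing.lean`; the seat's `OneStateTailTrivial.lean`.
-/

noncomputable section

open MeasureTheory Filter Function ProbabilityTheory Topology
open Literature.Probability.LatticeModels hiding configShift configShift_apply
open Literature.Probability.Percolation (coordShift)
open Literature.MathematicalPhysics.QuantumLattice
open Literature.MathematicalPhysics.QuantumFieldTheory hiding ZdEdge Site

namespace Summit.Ventures.YMGap.RobustBall

section Generic

variable {d : ℕ} {G : Type*} [MeasurableSpace G]

/-- **Short-range correlations + translation invariance ⇒ mixing on cylinder events** (Georgii 2011, Prop. 7.9 ⇒ mixing): if the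
probability measure `μ` on `LGConfig d G` is tail trivial and translation invariant, then for every event `A` and every cylinder event
`B = cylinder s T`: `μ(A ∩ θ_v⁻¹ B) → μ(A) μ(B)` along the cofinite filter of `ℤ^d`. [folklore] -/
theorem tendsto_measureReal_inter_preimage_configShift (μ : Measure (LGConfig d G)) [IsProbabilityMeasure μ]
    (hμ : IsTailTrivial μ) (hT : IsZdTranslationInvariant μ) {A : Set (LGConfig d G)} (hA : MeasurableSet A)
    (s : Finset (ZdEdge d)) {T : Set (s → G)} (hTm : MeasurableSet T) :
    Tendsto (fun v : Literature.Probability.LatticeModels.Site d => μ.real (A ∩ (configShift v) ⁻¹' cylinder s T)) cofinite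
      (𝓝 (μ.real A * μ.real (cylinder s T))) := by
  classical
  have hBm : MeasurableSet (cylinder s T : Set (LGConfig d G)) := MeasurableSet.cylinder s hTm
  refine Metric.tendsto_nhds.2 fun ε hε => ?_
  obtain ⟨Λ, hΛ⟩ := hμ.exists_finset_abs_measureReal_inter_sub_le hA (half_pos hε)
  -- the finitely many translations that move a link of `s` onto a link of `Λ`
  have hfin : {v : Literature.Probability.LatticeModels.Site d | ∃ i ∈ s, ((i.1 - v, i.2) : ZdEdge d) ∈ Λ}.Finite := by
    refine ((s ×ˢ Λ).finite_toSet.image fun p : ZdEdge d × ZdEdge d => p.1.1 - p.2.1).subset ?_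
    rintro v ⟨i, hi, hmem⟩
    refine ⟨(i, (i.1 - v, i.2)), Finset.mem_coe.2 (Finset.mk_mem_product hi hmem), ?_⟩
    simp
  refine Filter.eventually_cofinite.2 (hfin.subset fun v hv => ?_)
  -- for every other `v` the translated cylinder is determined off `Λ`
  by_contra hgood
  apply hv
  have hn : ∀ i ∈ s, (fun e : ZdEdge d => (e.1 - v, e.2)) i ∉ Λ := fun i hi hmem => hgood ⟨i, hi, hmem⟩
  have hBΛ : MeasurableSet[cylinderEvents (X := fun _ : ZdEdge d => G) ((↑Λ : Set (ZdEdge d))ᶜ)]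
      ((configShift v) ⁻¹' cylinder s T) := by
    rw [coe_configShift_eq_coordShift]
    exact measurableSet_cylinderEvents_preimage_coordShift_cylinder s Λ hn hTm
  have hinv : μ.real ((configShift v) ⁻¹' cylinder s T) = μ.real (cylinder s T) := by
    have h := hT v
    simp only [measureReal_def]
    rw [← Measure.map_apply (configShift (G := G) v).measurable hBm, h]
  have key := hΛ _ hBΛ
  rw [hinv] at key
  rw [Real.dist_eq]
  linarith

end Generic

section Wilson

variable {d N : ℕ}

/-- ★★ **UNDER `MassGapAt d N β` THE ONE STATE IS MIXING UNDER LATTICE TRANSLATIONS ON ALL EVENTS**: there is `μ` with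
`ymGibbsMeasures = {μ}` such that for every event `A` and every cylinder event `B = cylinder s T`,
`μ(A ∩ θ_v⁻¹ B) → μ(A) μ(B)` as `v → ∞` in `ℤ^d`. [folklore] -/
theorem oneState_mixing_of_massGapAt [NeZero d] {β : ℝ} (hgap : MassGapAt d N β) :
    ∃ μ : Measure (LGConfig d (SUN N)),
      ymGibbsMeasures (d := d) (fundamentalRep (Fin N)) ((N : ℝ) * β) = {μ} ∧
      ∀ (A : Set (LGConfig d (SUN N))), MeasurableSet A → ∀ (s : Finset (ZdEdge d)) (T : Set (s → SUN N)), MeasurableSet T →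
        Tendsto (fun v : Literature.Probability.LatticeModels.Site d => μ.real (A ∩ (configShift v) ⁻¹' cylinder s T)) cofinite
          (𝓝 (μ.real A * μ.real (cylinder s T))) := by
  obtain ⟨μ, hG, htail, -, -⟩ := oneState_tailTrivial_of_massGapAt hgap
  obtain ⟨μ', hG', hT⟩ := oneState_translationInvariant_of_massGapAt hgap
  have hμμ' : μ' = μ := Set.singleton_eq_singleton_iff.1 (hG'.symm.trans hG)
  rw [hμμ'] at hT
  have hμ : μ ∈ ymGibbsMeasures (d := d) (fundamentalRep (Fin N)) ((N : ℝ) * β) := by rw [hG]; exact Set.mem_singleton μ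
  have hμG : IsGibbsMeasure (ymSpecification (d := d) (fundamentalRep (Fin N)) ((N : ℝ) * β)) μ := hμ
  haveI := hμG.isProbabilityMeasure
  exact ⟨μ, hG, fun A hA s T hTm => tendsto_measureReal_inter_preimage_configShift μ htail hT hA s hTm⟩

/-- ★ **`SU(2)` on `ℤ⁴`, every `|b| ≤ 9/50`** (tree coupling `b`): the one state is mixing under translations on all events. [folklore] -/
theorem su2_wilson_oneState_mixing {b : ℝ} (h : |b| ≤ 9 / 50) :
    ∃ μ : Measure (LGConfig 4 (SUN 2)),
      ymGibbsMeasures (d := 4) (fundamentalRep (Fin 2)) b = {μ} ∧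
      ∀ (A : Set (LGConfig 4 (SUN 2))), MeasurableSet A → ∀ (s : Finset (ZdEdge 4)) (T : Set (s → SUN 2)), MeasurableSet T →
        Tendsto (fun v : Literature.Probability.LatticeModels.Site 4 => μ.real (A ∩ (configShift v) ⁻¹' cylinder s T)) cofinite
          (𝓝 (μ.real A * μ.real (cylinder s T))) := by
  have hm := ImprovedThresholdStar.su2_massGapAt_of_abs_le (β := b / 2) (by rw [abs_div, abs_two]; linarith)
  have e : (((2 : ℕ) : ℝ)) * (b / 2) = b := by push_cast; ring
  have h := oneState_mixing_of_massGapAt hm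
  rwa [e] at h

end Wilson

end Summit.Ventures.YMGap.RobustBall

end
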